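import Mathlib
import Summits.Ventures.HodgeRepro2.WeilPairing
import Summits.Ventures.HodgeRepro2.WeilVector

/-!
# A2 annex — Corollary A8.2: curve classes on `S` do not reach `W_F(B)` through the triple sum map

Sub-claim A2 (route/T4-A2-p6.md v6, Corollary A8.2) considers, for two algebraic `(1,1)`-classes
`c₁, c₂ ∈ NS(S)_ℚ` of the surface `S` and the triple sum `m₃ : B × B × B → B`, the algebraic class
`y' := m₃_*(f_*c₁ ⊗ f_*c₂ ⊗ θ⁴) ∈ H⁴(B, ℚ)` and proves `p_W(y') = 0`, i.e. (detection Lemma A5.6 of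
sub-claim A3) `⟨y', θ⁸ ∧ w_σ⟩ = 0` for every `σ`.  By Lemma A4.1.1 (ii) for `m₃` and for `f`,
`⟨y', u⟩ = ∫_{B³} (f_*c₁ ⊗ f_*c₂ ⊗ θ⁴) ∪ m₃^* u`, and in the twelve-plane model of A5.3 (p5's
`WeilPlanes` / `WeilIntegral` / `WeilCoproduct` / `WeilPairing`, where `H^*(B, ℂ) = ⋀^* H¹(B, ℂ)` is the
exterior algebra `A ι` on the generators `a_p, b_p` of the planes `p ∈ ι`, `∫_B` is `integral`, and
`m^* = Δ` is the coproduct `cop`) this pairing is the Künneth-expanded functional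
`u ↦ Σ Φ₁(u₍₁₎) Φ₂(u₍₂₎) Ψ(u₍₃₎)` with `(Δ ⊗ id)(Δ u) = Σ u₍₁₎ ⊗ u₍₂₎ ⊗ u₍₃₎`, `Φⱼ = ∫_B f_*cⱼ ∧ (·)`
(`= ∫_S cⱼ ∪ f^*(·)`) and `Ψ = ∫_B θ⁴ ∧ (·)`; no Koszul sign occurs because `f_*c₁`, `f_*c₂` and `θ⁴`
have even degree (A2.0 (b), as stated in the printed proof: «all degrees even, so no signs»), and
`m₃^* = (Δ ⊗ id) ∘ Δ` because `m₃ = m ∘ (m × id_B)`.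

This file kernel-checks the ALGEBRA of that proof in the model, for an arbitrary finite plane set `ι`
and an arbitrary Weil plane set `P₀`:

* `pairThree Φ₁ Φ₂ Ψ` is the functional above (`pairTwo` is the two-fold `Φ₁ ⊗ Φ₂`);
* `psi_eq_zero_of_mem_Bad`: `Ψ = ∫_B θ^{|P₀|} ∧ (·)` kills p5's `Bad` right factors (from p5's
  `II_pair_K_eq_zero` against the volume form);
* `pairThreeAux_eq_zero_of_mem_K`: hence `(Φ₁ ⊗ Φ₂) ∘ Δ ⊗ Ψ` kills p5's submodule `K`;
* `cop_ET_mul_wL_sub_mem_K`: p5's invariant `cop_prod_sub_main_mem` in the form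
  `Δ(E_{I_σ} ∧ w_σ) ≡ w_σ ⊗ E_{I_σ} (mod K)` — every other term of the expansion has a right factor
  that `θ⁴` cannot complete to the volume form (step «∫_B θ⁴ ∪ u''' ≠ 0 forces u''' = E_{I_σ}» of the
  printed proof);
* `cop_mono_mem_span`: `Δ(e₁ ∧ ⋯ ∧ e_n) ∈ span { x ⊗ (e_{j₁} ∧ ⋯ ∧ e_{j_k}) }` (the distribution of the
  four vectors `e_{i,σ}` between the first two tensor factors; signs absorbed by the span);
* `pairTwo_cop_mono_eq_zero`: if `Φ₂` vanishes on every monomial of length `≠ 2` (`f_*c₂` has degree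
  `22`) and on every `e_{a,σ} ∧ e_{b,σ}` with `a ≠ b` (Proposition A8.1), then `(Φ₁ ⊗ Φ₂)(Δ w_σ) = 0`;
* **`pairThree_theta_pow_mul_weil_eq_zero`** (Corollary A8.2, model form): under these hypotheses on
  `Φ₂` alone, `⟨y', θ^{|univ ∖ P₀|} ∧ w_σ⟩ = 0`; **`pairThree_integral_eq_zero`** is the same with
  `Φⱼ = ∫_B zⱼ ∧ (·)`.

The printed proof uses the hypothesis of Prop. A8.1 for BOTH `c₁` and `c₂`; the kernel shows that the
hypothesis for `c₂` alone suffices (each surviving term carries a factor `∫_S c₂ ∪ f_c^*e_{c,σ} ∧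
f_d^*e_{d,σ}`), so the theorem here is slightly stronger than the text.  What stays prose: the
identification `⟨y', u⟩ = ∫_{B³} (f_*c₁ ⊗ f_*c₂ ⊗ θ⁴) ∪ m₃^* u` (Lemma A4.1.1 (ii), Künneth, Bredon
Cor. 5.3), the geometric input `deg f_*cⱼ = 22`, Prop. A8.1 itself, and the detection Lemma A5.6
(p5's `integral_sum_mul_ET_mul_weil` in coordinates).

Seat p6 (A2 owner), gen 16.  §8 (d): uses an L-value-free non-vanishing device: NO.
-/

namespace Summit.Ventures.HodgeRepro2.A2TripleSumPairing

open WeilPlanes WeilIntegral WeilDetect WeilCoproduct WeilPairing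
open scoped TensorProduct

variable {ι : Type*} [DecidableEq ι]

/-- The two-fold pairing `Φ₁ ⊗ Φ₂ : A ⊗ A → ℂ` on the graded tensor product `AA ι = A ι ᵍ⊗[ℂ] A ι`
(the model of `H^*(B × B)`): `x ᵍ⊗ y ↦ Φ₁ x * Φ₂ y`. -/
noncomputable def pairTwo (Φ₁ Φ₂ : A ι →ₗ[ℂ] ℂ) : AA ι →ₗ[ℂ] ℂ :=
  TensorProduct.lift ((LinearMap.mul ℂ ℂ).compl₁₂ Φ₁ Φ₂) ∘ₗ
    (GradedTensorProduct.of ℂ (grading ι) (grading ι)).symm.toLinearMap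

/-- `pairTwo` on a pure tensor. -/
@[simp] theorem pairTwo_tmul (Φ₁ Φ₂ : A ι →ₗ[ℂ] ℂ) (x y : A ι) :
    pairTwo Φ₁ Φ₂ (x ᵍ⊗ₜ[ℂ] y) = Φ₁ x * Φ₂ y := by
  simp [pairTwo, GradedTensorProduct.tmul]

/-- The functional `(Φ₁ ⊗ Φ₂ ⊗ Ψ) ∘ (Δ ⊗ id)` on `AA ι`: on a pure tensor `x ᵍ⊗ y` it is
`(Φ₁ ⊗ Φ₂)(Δ x) * Ψ y`. -/
noncomputable def pairThreeAux (Φ₁ Φ₂ Ψ : A ι →ₗ[ℂ] ℂ) : AA ι →ₗ[ℂ] ℂ :=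
  pairTwo (pairTwo Φ₁ Φ₂ ∘ₗ cop.toLinearMap) Ψ

/-- `pairThreeAux` on a pure tensor. -/
@[simp] theorem pairThreeAux_tmul (Φ₁ Φ₂ Ψ : A ι →ₗ[ℂ] ℂ) (x y : A ι) :
    pairThreeAux Φ₁ Φ₂ Ψ (x ᵍ⊗ₜ[ℂ] y) = pairTwo Φ₁ Φ₂ (cop x) * Ψ y := by
  simp [pairThreeAux]

/-- The triple pairing `u ↦ (Φ₁ ⊗ Φ₂ ⊗ Ψ)(m₃^* u)` with `m₃^* = (Δ ⊗ id) ∘ Δ` (`m₃ = m ∘ (m × id)`):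
the model of `u ↦ ∫_{B³} (z₁ ⊗ z₂ ⊗ v) ∪ m₃^* u = ⟨m₃_*(z₁ ⊗ z₂ ⊗ v), u⟩` for `Φⱼ = ∫_B zⱼ ∧ (·)`,
`Ψ = ∫_B v ∧ (·)`, valid without signs when `z₁, z₂, v` have even degree (A2.0 (b)). -/
noncomputable def pairThree (Φ₁ Φ₂ Ψ : A ι →ₗ[ℂ] ℂ) : A ι →ₗ[ℂ] ℂ :=
  pairThreeAux Φ₁ Φ₂ Ψ ∘ₗ cop.toLinearMap

/-- Unfolding `pairThree`. -/
theorem pairThree_apply (Φ₁ Φ₂ Ψ : A ι →ₗ[ℂ] ℂ) (u : A ι) :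
    pairThree Φ₁ Φ₂ Ψ u = pairThreeAux Φ₁ Φ₂ Ψ (cop u) := rfl

/-- The functional `Ψ_r := ∫_B θ^r ∧ (·)` (with `r = |P₀| = 4` in the section: the `θ⁴` of `y'`). -/
noncomputable def psi [Fintype ι] (c : ι → ℂ) (r : ℕ) : A ι →ₗ[ℂ] ℂ :=
  integral ∘ₗ LinearMap.mulLeft ℂ (theta c ^ r)

/-- Unfolding `psi`. -/
@[simp] theorem psi_apply [Fintype ι] (c : ι → ℂ) (r : ℕ) (y : A ι) :
    psi c r y = integral (theta c ^ r * y) := rfl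

/-- `Ψ_{|P₀|}` kills every right factor of p5's `Bad univ (univ \ P₀)` (proved against the volume form
`ET univ`, `integral (ET univ) = vol ≠ 0`, from p5's `II_pair_K_eq_zero`). -/
theorem psi_eq_zero_of_mem_Bad [Fintype ι] (P₀ : Finset ι) (c : ι → ℂ) {y : A ι}
    (hy : y ∈ Bad (Finset.univ : Finset ι) (Finset.univ \ P₀)) : psi c P₀.card y = 0 := by
  have hK : (1 : A ι) ᵍ⊗ₜ[ℂ] y ∈ K (Finset.univ : Finset ι) (Finset.univ \ P₀) := tmul_mem_K 1 hy
  have h0 := II_pair_K_eq_zero P₀ (ET (Finset.univ : Finset ι)) c hK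
  rw [II_pair_tmul, mul_one] at h0
  have hvol : integral (ET (Finset.univ : Finset ι)) ≠ 0 := vol_ne_zero ι
  simpa [psi_apply] using (mul_eq_zero.mp h0).resolve_left hvol

/-- `(Φ₁ ⊗ Φ₂) ∘ Δ ⊗ Ψ_{|P₀|}` kills p5's submodule `K univ (univ \ P₀)`. -/
theorem pairThreeAux_eq_zero_of_mem_K [Fintype ι] (P₀ : Finset ι) (c : ι → ℂ) (Φ₁ Φ₂ : A ι →ₗ[ℂ] ℂ)
    {Z : AA ι} (hZ : Z ∈ K (Finset.univ : Finset ι) (Finset.univ \ P₀)) :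
    pairThreeAux Φ₁ Φ₂ (psi c P₀.card) Z = 0 := by
  induction hZ using Submodule.span_induction with
  | mem Z hZ =>
    obtain ⟨x, y, hy, rfl⟩ := hZ
    rw [pairThreeAux_tmul, psi_eq_zero_of_mem_Bad P₀ c hy, mul_zero]
  | zero => exact map_zero _
  | add Z Z' _ _ hZ hZ' => rw [map_add, hZ, hZ', add_zero]
  | smul a Z _ hZ => rw [map_smul, hZ, smul_zero]

/-- p5's invariant `cop_prod_sub_main_mem` on the full plane list: in the model,
`Δ(E_{I_σ} ∧ w_σ) ≡ w_σ ⊗ E_{I_σ}  (mod K univ (univ \ P₀))` — every other term of the expansion of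
`m₃^*(E_{I_σ} ∧ w_σ)` (the printed proof's «each factor `E_{i,ν}` contributes … and each factor
`e_{i,σ}` contributes …») has a right factor that `θ⁴` cannot complete to the volume form.  Here
`I_σ = univ \ P₀` and `w_σ = wL P₀ s univ.toList` (`= ± weil P₀ s`, p5's `wL_eq_smul_weil`). -/
theorem cop_ET_mul_wL_sub_mem_K [Fintype ι] (P₀ : Finset ι) (s : Bool) :
    cop (ET (Finset.univ \ P₀) * wL P₀ s (Finset.univ : Finset ι).toList) -
        wL P₀ s (Finset.univ : Finset ι).toList ᵍ⊗ₜ[ℂ] ET (Finset.univ \ P₀) ∈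
      K (Finset.univ : Finset ι) (Finset.univ \ P₀) := by
  have h := cop_prod_sub_main_mem P₀ s (Finset.univ : Finset ι).toList (Finset.nodup_toList _)
  rwa [prod_map_F P₀ s _ (Finset.nodup_toList _), TL_univ, Finset.toList_toFinset] at h

/-- The surviving term: `⟨y', E_{I_σ} ∧ w_σ⟩ = (Φ₁ ⊗ Φ₂)(Δ w_σ) · ∫_B θ^{|P₀|} ∧ E_{I_σ}` — the
printed proof's reduction «so in every factor indexed by `I_σ` the term `1 ⊗ 1 ⊗ E_{i,ν}` was chosen,
and the four vectors `e_{i,σ}` are distributed between the first two tensor factors». -/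
theorem pairThree_ET_mul_wL [Fintype ι] (P₀ : Finset ι) (s : Bool) (c : ι → ℂ)
    (Φ₁ Φ₂ : A ι →ₗ[ℂ] ℂ) :
    pairThree Φ₁ Φ₂ (psi c P₀.card) (ET (Finset.univ \ P₀) * wL P₀ s (Finset.univ : Finset ι).toList) =
      pairTwo Φ₁ Φ₂ (cop (wL P₀ s (Finset.univ : Finset ι).toList)) *
        psi c P₀.card (ET (Finset.univ \ P₀)) := by
  rw [pairThree_apply, ← sub_add_cancel (cop (ET (Finset.univ \ P₀) * wL P₀ s (Finset.univ : Finset ι).toList))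
    (wL P₀ s (Finset.univ : Finset ι).toList ᵍ⊗ₜ[ℂ] ET (Finset.univ \ P₀)), map_add,
    pairThreeAux_eq_zero_of_mem_K P₀ c Φ₁ Φ₂ (cop_ET_mul_wL_sub_mem_K P₀ s), zero_add,
    pairThreeAux_tmul]

/-- The set of pure tensors whose right factor is a sub-monomial of `mono l`. -/
def rightSubmono (l : List (Gen ι)) : Set (AA ι) :=
  {Z | ∃ x : A ι, ∃ l₂ : List (Gen ι), l₂.Sublist l ∧ Z = x ᵍ⊗ₜ[ℂ] mono l₂}

/-- `mono` of a cons. -/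
theorem mono_cons (j : Gen ι) (l : List (Gen ι)) : mono (j :: l) = gen j * mono l := by
  simp [mono]

/-- The expansion of `Δ(e₁ ∧ ⋯ ∧ e_n)`: every term is `± (sub-monomial) ⊗ (complementary
sub-monomial)`; recorded with the left factor free and the signs absorbed by the span. -/
theorem cop_mono_mem_span (l : List (Gen ι)) :
    cop (mono l) ∈ Submodule.span ℂ (rightSubmono l) := by
  induction l with
  | nil =>
    refine Submodule.subset_span ⟨1, [], List.Sublist.refl _, ?_⟩
    simp [mono, one_eq_tmul_one]
  | cons g l ih =>
    rw [mono_cons, map_mul, cop_gen, add_mul]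
    refine Submodule.add_mem _ ?_ ?_
    · refine Submodule.span_induction
        (p := fun Z _ => inl (gen g) * Z ∈ Submodule.span ℂ (rightSubmono (g :: l))) ?_ ?_ ?_ ?_ ih
      · rintro Z ⟨x, l₂, hl₂, rfl⟩
        rw [inl_mul_tmul]
        exact Submodule.subset_span ⟨gen g * x, l₂, hl₂.cons g, rfl⟩
      · simp
      · intro Z Z' _ _ hZ hZ'
        rw [mul_add]
        exact Submodule.add_mem _ hZ hZ'
      · intro a Z _ hZ
        rw [mul_smul_comm]
        exact Submodule.smul_mem _ a hZ
    · refine Submodule.span_induction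
        (p := fun Z _ => inr (gen g) * Z ∈ Submodule.span ℂ (rightSubmono (g :: l))) ?_ ?_ ?_ ?_ ih
      · rintro Z ⟨x, l₂, hl₂, rfl⟩
        refine Submodule.span_mono ?_ (inr_gen_mul_tmul_mem g x (mono l₂))
        rintro _ ⟨x', rfl⟩
        exact ⟨x', g :: l₂, hl₂.cons_cons g, by rw [mono_cons]⟩
      · simp
      · intro Z Z' _ _ hZ hZ'
        rw [mul_add]
        exact Submodule.add_mem _ hZ hZ'
      · intro a Z _ hZ
        rw [mul_smul_comm]
        exact Submodule.smul_mem _ a hZ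

/-- The vanishing of `(Φ₁ ⊗ Φ₂)(Δ(e₁ ∧ ⋯ ∧ e_n))` for a list of distinct generators `(a, s)`, `a ∈ P₀`,
when `Φ₂` kills every monomial of length `≠ 2` (`f_*c₂` has degree `22`, so `∫_B f_*c₂ ∧ (·)` lives
on degree `2`) and every `e_{a,σ} ∧ e_{b,σ}`, `a ≠ b` (Proposition A8.1): every term of the expansion
carries a factor `Φ₂(sub-monomial)`, which is `0` by degree unless the sub-monomial is a pair
`e_{a,σ} ∧ e_{b,σ}`, and then by A8.1. -/
theorem pairTwo_cop_mono_eq_zero (P₀ : Finset ι) (s : Bool) (Φ₁ Φ₂ : A ι →ₗ[ℂ] ℂ)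
    (hdeg : ∀ l : List (Gen ι), l.length ≠ 2 → Φ₂ (mono l) = 0)
    (hA81 : ∀ a ∈ P₀, ∀ b ∈ P₀, a ≠ b → Φ₂ (gen (a, s) * gen (b, s)) = 0)
    (l : List (Gen ι)) (hl : l.Nodup) (hlP : ∀ j ∈ l, j.1 ∈ P₀ ∧ j.2 = s) :
    pairTwo Φ₁ Φ₂ (cop (mono l)) = 0 := by
  have key : ∀ l₂ : List (Gen ι), l₂.Sublist l → Φ₂ (mono l₂) = 0 := by
    intro l₂ hl₂
    by_cases h2 : l₂.length = 2
    · obtain ⟨j, k, rfl⟩ := List.length_eq_two.mp h2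
      have hnd : [j, k].Nodup := hl₂.nodup hl
      have hjk : j ≠ k := by
        simpa [List.nodup_cons] using hnd
      have hj := hlP j (hl₂.subset (by simp))
      have hk := hlP k (hl₂.subset (by simp))
      have hjk1 : j.1 ≠ k.1 := by
        intro h
        exact hjk (Prod.ext h (hj.2.trans hk.2.symm))
      have hj' : j = (j.1, s) := Prod.ext rfl hj.2
      have hk' : k = (k.1, s) := Prod.ext rfl hk.2
      rw [mono_cons, mono_cons, mono, List.map_nil, List.prod_nil, mul_one, hj', hk']
      exact hA81 j.1 hj.1 k.1 hk.1 hjk1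
    · exact hdeg l₂ h2
  refine Submodule.span_induction (p := fun Z _ => pairTwo Φ₁ Φ₂ Z = 0) ?_ ?_ ?_ ?_
    (cop_mono_mem_span l)
  · rintro Z ⟨x, l₂, hl₂, rfl⟩
    rw [pairTwo_tmul, key l₂ hl₂, mul_zero]
  · exact map_zero _
  · intro Z Z' _ _ hZ hZ'
    rw [map_add, hZ, hZ', add_zero]
  · intro a Z _ hZ
    rw [map_smul, hZ, smul_zero]

/-- The generator list of `wL P₀ s univ.toList`. -/
theorem wL_univ_eq_mono [Fintype ι] (P₀ : Finset ι) (s : Bool) :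
    wL P₀ s (Finset.univ : Finset ι).toList =
      mono (List.map (fun p => (p, s)) (List.filter (fun p => decide (p ∈ P₀))
        (Finset.univ : Finset ι).toList)) := rfl

/-- **Corollary A8.2 (model form, `w_σ = wL`).**  For `Φ₂` killing every monomial of length `≠ 2`
and every `e_{a,σ} ∧ e_{b,σ}` (`a ≠ b` in `P₀`), the triple pairing of `z₁ ⊗ z₂ ⊗ θ^{|P₀|}` with
`θ^{|univ ∖ P₀|} ∧ w_σ` vanishes, for every `Φ₁` and every `c`. -/
theorem pairThree_theta_pow_mul_wL_eq_zero [Fintype ι] (P₀ : Finset ι) (s : Bool) (c : ι → ℂ)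
    (Φ₁ Φ₂ : A ι →ₗ[ℂ] ℂ)
    (hdeg : ∀ l : List (Gen ι), l.length ≠ 2 → Φ₂ (mono l) = 0)
    (hA81 : ∀ a ∈ P₀, ∀ b ∈ P₀, a ≠ b → Φ₂ (gen (a, s) * gen (b, s)) = 0) :
    pairThree Φ₁ Φ₂ (psi c P₀.card)
      (theta c ^ (Finset.univ \ P₀).card * wL P₀ s (Finset.univ : Finset ι).toList) = 0 := by
  have hE : ∀ p ∈ P₀, E p * wL P₀ s (Finset.univ : Finset ι).toList = 0 := fun p hp =>
    E_mul_wL P₀ s _ hp (Finset.mem_toList.mpr (Finset.mem_univ p))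
  have hnd : (List.map (fun p => (p, s)) (List.filter (fun p => decide (p ∈ P₀))
      (Finset.univ : Finset ι).toList)).Nodup :=
    (List.Nodup.filter _ (Finset.nodup_toList _)).map (fun p q h => by simpa using h)
  have hP : ∀ j ∈ List.map (fun p => (p, s)) (List.filter (fun p => decide (p ∈ P₀))
      (Finset.univ : Finset ι).toList), j.1 ∈ P₀ ∧ j.2 = s := by
    intro j hj
    obtain ⟨p, hp, rfl⟩ := List.mem_map.mp hj
    exact ⟨by simpa using (List.mem_filter.mp hp).2, rfl⟩
  rw [theta_pow_card_mul c P₀ _ hE, map_smul, pairThree_ET_mul_wL, wL_univ_eq_mono,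
    pairTwo_cop_mono_eq_zero P₀ s Φ₁ Φ₂ hdeg hA81 _ hnd hP, zero_mul, smul_zero]

/-- **Corollary A8.2 (model form, `w_σ = weil P₀ s`).**  The same for p5's `weil P₀ s` (`= ± wL`,
`wL_eq_smul_weil`): `⟨y', θ^{|univ ∖ P₀|} ∧ w_σ⟩ = 0` for every `Φ₁`, every `c`, and every `Φ₂`
killing the monomials of length `≠ 2` and the pairs `e_{a,σ} ∧ e_{b,σ}`, `a ≠ b` in `P₀`. -/
theorem pairThree_theta_pow_mul_weil_eq_zero [Fintype ι] (P₀ : Finset ι) (s : Bool) (c : ι → ℂ)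
    (Φ₁ Φ₂ : A ι →ₗ[ℂ] ℂ)
    (hdeg : ∀ l : List (Gen ι), l.length ≠ 2 → Φ₂ (mono l) = 0)
    (hA81 : ∀ a ∈ P₀, ∀ b ∈ P₀, a ≠ b → Φ₂ (gen (a, s) * gen (b, s)) = 0) :
    pairThree Φ₁ Φ₂ (psi c P₀.card) (theta c ^ (Finset.univ \ P₀).card * weil P₀ s) = 0 := by
  obtain ⟨ε, hε, hw⟩ := WeilVector.wL_eq_smul_weil P₀ s
  have hε0 : ε ≠ 0 := by rcases hε with rfl | rfl <;> norm_num
  have h := pairThree_theta_pow_mul_wL_eq_zero P₀ s c Φ₁ Φ₂ hdeg hA81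
  rw [hw, mul_smul_comm, map_smul, smul_eq_zero] at h
  exact h.resolve_left hε0

/-- **Corollary A8.2 (integral form).**  With `Φⱼ = ∫_B zⱼ ∧ (·)` (the model of
`∫_S cⱼ ∪ f^*(·) = ∫_B f_*cⱼ ∧ (·)`, Lemma A4.1.1 (ii)) and `Ψ = ∫_B θ^{|P₀|} ∧ (·)`: if `z₂` pairs
only with degree `2` (`deg f_*c₂ = 22`: `∫_B z₂ ∧ (monomial of length ≠ 2) = 0`) and
`∫_B z₂ ∧ e_{a,σ} ∧ e_{b,σ} = 0` for all `a ≠ b` in `P₀` (Proposition A8.1 for `c₂`), then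
`⟨m₃_*(z₁ ⊗ z₂ ⊗ θ^{|P₀|}), θ^{|univ ∖ P₀|} ∧ w_σ⟩ = 0` for every `z₁` and every `c`. -/
theorem pairThree_integral_eq_zero [Fintype ι] (P₀ : Finset ι) (s : Bool) (c : ι → ℂ)
    (z₁ z₂ : A ι)
    (hdeg : ∀ l : List (Gen ι), l.length ≠ 2 → integral (z₂ * mono l) = 0)
    (hA81 : ∀ a ∈ P₀, ∀ b ∈ P₀, a ≠ b → integral (z₂ * (gen (a, s) * gen (b, s))) = 0) :
    pairThree (integral ∘ₗ LinearMap.mulLeft ℂ z₁) (integral ∘ₗ LinearMap.mulLeft ℂ z₂)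
      (psi c P₀.card) (theta c ^ (Finset.univ \ P₀).card * weil P₀ s) = 0 :=
  pairThree_theta_pow_mul_weil_eq_zero P₀ s c _ _ (fun l hl => hdeg l hl)
    (fun a ha b hb hab => hA81 a ha b hb hab)

/-- Sanity check of the triple pairing on a pure-tensor-like input: for `u = 1`,
`pairThree Φ₁ Φ₂ Ψ 1 = Φ₁ 1 * Φ₂ 1 * Ψ 1` (`Δ 1 = 1 ⊗ 1`). -/
theorem pairThree_one (Φ₁ Φ₂ Ψ : A ι →ₗ[ℂ] ℂ) :
    pairThree Φ₁ Φ₂ Ψ 1 = Φ₁ 1 * Φ₂ 1 * Ψ 1 := by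
  rw [pairThree_apply, map_one, one_eq_tmul_one, pairThreeAux_tmul, map_one, one_eq_tmul_one,
    pairTwo_tmul]

end Summit.Ventures.HodgeRepro2.A2TripleSumPairing
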